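import Literature.AlgebraicGeometry.Resolution.HilbertSamuelSemicontinuityExcellentDim
import Literature.AlgebraicGeometry.Resolution.HilbertSamuelGenericConstancyExcellent
import Literature.AlgebraicGeometry.Resolution.ExcellentRingsFieldProofs
import Mathlib.AlgebraicGeometry.Morphisms.Proper
import Mathlib.AlgebraicGeometry.Noetherian
import Mathlib.Order.WellFounded
import HarnessLib

/-!
# `ModificationsResolve` (crux stmt-ResolutionOfSingularities-18507), line `Sketch` —
stub `stub_wellFounded_hsStep` (termination, CJS Thm. 6.17)

Helper file (`--supports stmt-ResolutionOfSingularities-18507`; does not close the item).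

For a field `k` and a level `N`, the ONE-STEP relation on `Scheme.{0}`
`R_{k,N} Y' Y` — "`Y` is a non-empty `k`-scheme locally of finite type and quasi-compact over
`k` with `dim Y < N`, and there is a proper `π : Y' ⟶ Y` along which the Hilbert–Samuel function
`H^N` does not increase and after which no maximal value of `H^N_Y` is a value of `H^N_{Y'}`" —
is WELL FOUNDED.  Proof: by `wellFounded_iff_isEmpty_descending_chain`, a descending chain
`f : ℕ → Scheme` with `R (f (n+1)) (f n)` for all `n` is an infinite tower of non-empty Noetherian
schemes (finite type over a field), excellent (`Scheme.isExcellent_of_locallyOfFiniteType` with the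
discharged fact `Stacks07QW_field_holds`), with `ψ ≤ N` (`Scheme.hsPsi_lt_of_dim_lt`), proper
transition maps along which `H^N` does not increase, and (ME2) at every step — exactly what
`Scheme.no_infinite_hsFun_tower_of_isExcellent` (CJS Thm. 6.17 in termination form, proved in the
tree) forbids.

Source: V. Cossart, U. Jannsen, S. Saito, *Desingularization: Invariants and Strategy*,
LNM 2270 (2020), Thm. 6.17, Cor. 6.18.
-/

set_option linter.dupNamespace false -- mandated namespace of this single-conjunct summit

noncomputable section

open CategoryTheory AlgebraicGeometry TopologicalSpace
open Literature.AlgebraicGeometry.Resolution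

namespace Summit.ResolutionOfSingularities.ResolutionOfSingularities.Theorems.ModificationsResolve.Sketch

/-- **Termination (CJS Thm. 6.17) as well-foundedness of the one-step relation.** For a field
`k` and `N : ℕ`, the relation `R_{k,N} Y' Y` on `Scheme.{0}` — `Y` non-empty, locally of finite
type and quasi-compact over `k`, `dim Y < N`, and a proper `π : Y' ⟶ Y` with
`H^N_{Y'}(x') ≤ H^N_Y(π x')` for all `x'` and no maximal value of `H^N_Y` among the values of
`H^N_{Y'}` — is well founded: a descending chain would be an infinite tower of non-empty Noetherian
excellent schemes with `ψ ≤ N`, non-increasing `H^N` and (ME2), contradicting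
`Scheme.no_infinite_hsFun_tower_of_isExcellent`. [cite: CossartJannsenSaito2020, Thm. 6.17] -/
theorem stub_wellFounded_hsStep (k : Type) [Field k] (N : ℕ) :
    WellFounded (fun Y' Y : Scheme.{0} =>
      (∃ g : Y ⟶ Spec (.of k), LocallyOfFiniteType g ∧ QuasiCompact g) ∧ Nonempty Y ∧
        topologicalKrullDim Y < (N : WithBot ℕ∞) ∧
        ∃ π : Y' ⟶ Y, IsProper π ∧
          (∀ x' : Y', Scheme.hsFun Y' N x' ≤ Scheme.hsFun Y N (π.base x')) ∧
          ∀ ν : ℕ → ℕ, Maximal (· ∈ Scheme.hsValues Y N) ν → ν ∉ Scheme.hsValues Y' N) := by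
  rw [wellFounded_iff_isEmpty_descending_chain]
  refine ⟨fun ⟨f, hf⟩ => ?_⟩
  -- unpack the chain: every `f n` is a stage, every step carries a proper `π n`
  have hf' : ∀ n, (∃ g : f n ⟶ Spec (.of k), LocallyOfFiniteType g ∧ QuasiCompact g) ∧
      Nonempty (f n) ∧ topologicalKrullDim (f n) < (N : WithBot ℕ∞) ∧
      ∃ π : f (n + 1) ⟶ f n, IsProper π ∧
        (∀ x' : f (n + 1), Scheme.hsFun (f (n + 1)) N x' ≤ Scheme.hsFun (f n) N (π.base x')) ∧
        ∀ ν : ℕ → ℕ, Maximal (· ∈ Scheme.hsValues (f n) N) ν →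
          ν ∉ Scheme.hsValues (f (n + 1)) N :=
    hf
  have hg : ∀ n, ∃ g : f n ⟶ Spec (.of k), LocallyOfFiniteType g ∧ QuasiCompact g :=
    fun n => (hf' n).1
  have hne : ∀ n, Nonempty (f n) := fun n => (hf' n).2.1
  have hdim : ∀ n, topologicalKrullDim (f n) < (N : WithBot ℕ∞) := fun n => (hf' n).2.2.1
  have hπ : ∀ n, ∃ π : f (n + 1) ⟶ f n,
      (∀ x' : f (n + 1), Scheme.hsFun (f (n + 1)) N x' ≤ Scheme.hsFun (f n) N (π.base x')) ∧
        ∀ ν : ℕ → ℕ, Maximal (· ∈ Scheme.hsValues (f n) N) ν →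
          ν ∉ Scheme.hsValues (f (n + 1)) N := fun n => by
    obtain ⟨π, -, hmono, hME2⟩ := (hf' n).2.2.2
    exact ⟨π, hmono, hME2⟩
  choose g hlft hqc using hg
  choose π hmono hME2 using hπ
  haveI : ∀ n, IsLocallyNoetherian (f n) := fun n => by
    haveI := hlft n
    exact LocallyOfFiniteType.isLocallyNoetherian (g n)
  haveI : ∀ n, IsNoetherian (f n) := fun n => by
    haveI := hqc n
    haveI : CompactSpace (f n) := QuasiCompact.compactSpace_of_compactSpace (g n)
    exact {}
  refine Scheme.no_infinite_hsFun_tower_of_isExcellent (fun n => f n) (fun n => ?_) N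
    (fun n x => ?_) π hmono hne hME2
  · haveI := hlft n
    exact Scheme.isExcellent_of_locallyOfFiniteType Stacks07QW_field_holds (g n)
  · exact (Scheme.hsPsi_lt_of_dim_lt (hdim n) x).le

end Summit.ResolutionOfSingularities.ResolutionOfSingularities.Theorems.ModificationsResolve.Sketch

end
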